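import Summits.CriticalPhenomena.PercolationContinuityZ3.Theorems.PercNearOneGluingNoHeavyLowerTailKNGoodGMgcSideGlue
import Summits.CriticalPhenomena.PercolationContinuityZ3.Theorems.PercNearOneGluingAdditiveGluingTripleTieRaise
import HarnessLib

/-!
# World mixture: core reliabilities of THEOREM B's `K` as a five-world mixture; the loneliness rows in world-law form
# (`NoHeavyLowerTail` cell, stmt-CriticalPhenomena-4575; prover `prim-hp-2`, gen 19 — bricks L4 (= S1 + S3) of the semantic layer,
# memo `run/shared/lean/prim/prim-hp-2/MEMO-gen17-lean-certificates.md` §4')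

Support file (`--supports stmt-CriticalPhenomena-4575`; imports the COMPUTATIONAL `…KNGoodGMgcSideGlue`).  Two small definitions
(`Verts.X` = the twelve side weights as a real vector, `Verts.rel` = reliabilities of the glued cores), no named facts, no sorries.
* `sideWorld_cases` — every configuration's world is one of `0,3,5,6,7` (`d,[12],[13],[23],[123]`).
* **`Verts.real_openConn_worldMix`** — for a pendant `u` and `p, q ∉ {x,y,z}`:
  `μ_u(p ↔ q) = Σ_{π ∈ {0,3,5,6,7}} bexp 12 (qHat [π]) X · μ_{glued u π}(p ↔ q)`  (`real_eq_bexpR_force` + `real_openConn_force_side`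
  pointwise + linearity of `bexpR`); `bexp 12 (qHat [π]) X` is `KNGoodGMgc.worldQ π X` of `…KNGoodGMgcCertificate`.
* `Verts.rel_tie_*` — glued relays are equally reliable (`[12]: a₁ ≈ a₂`, `[13]: a₁ ≈ a₃`, `[23]: a₂ ≈ a₃`, `[123]`: all three).
* **`Verts.row_21 / row_31 / row_32`** — the reliability differences of the relays in `K` in the five core scalars
  `α = s₂−s₁, β = s₃−s₂, γ = s₁₃−t₂, δ = s₂₃−t₁, ε = s₁₂−t₃` (MEMO-gen15 §3b):
  `μ_u(a₂ b) − μ_u(a₁ b) = Q_d α − Q₁₃ γ + Q₂₃ δ`, `μ_u(a₃ b) − μ_u(a₁ b) = Q_d (α+β) − Q₁₂ ε + Q₂₃ δ`,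
  `μ_u(a₃ b) − μ_u(a₂ b) = Q_d β − Q₁₂ ε + Q₁₃ γ` — the hypotheses `h1/h2/h3` of `KNGoodGMgc.certificate_j*`.
-/

noncomputable section

namespace Summit.CriticalPhenomena.PercolationContinuityZ3.Theorems

namespace KNGoodGMgc

open MeasureTheory Set Literature.Probability.LatticeModels Literature.Probability.Percolation
open scoped Classical

variable {n : ℕ}

/-- Every twelve-bit configuration has world `0, 3, 5, 6` or `7` (check). [this work] -/
theorem sideWorld_cases_mk12 : ∀ b0 b1 b2 b3 b4 b5 b6 b7 b8 b9 b10 b11 : Bool,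
    (decide (sideWorld (mk12 b0 b1 b2 b3 b4 b5 b6 b7 b8 b9 b10 b11) ∈ [0, 3, 5, 6, 7])) = true := by
  decide

/-- Every configuration has world `d, [12], [13], [23]` or `[123]`. [this work] -/
theorem sideWorld_cases (c : Cfg) :
    sideWorld c = 0 ∨ sideWorld c = 3 ∨ sideWorld c = 5 ∨ sideWorld c = 6 ∨ sideWorld c = 7 := by
  have h := of_decide_eq_true (sideWorld_cases_mk12 (c 0) (c 1) (c 2) (c 3) (c 4) (c 5) (c 6) (c 7) (c 8) (c 9) (c 10) (c 11))
  rw [sideWorld_trunc c]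
  change sideWorld (trunc c) ∈ [0, 3, 5, 6, 7] at h
  simpa using h

/-- Linearity of `bexpR` over five summands with constant factors. [folklore] -/
theorem bexpR_five (m : ℕ) (f₀ f₁ f₂ f₃ f₄ : Cfg → ℤ) (r₀ r₁ r₂ r₃ r₄ : ℝ) (x : ℕ → ℝ) :
    bexpR m (fun c => (f₀ c : ℝ) * r₀ + (f₁ c : ℝ) * r₁ + (f₂ c : ℝ) * r₂ + (f₃ c : ℝ) * r₃ + (f₄ c : ℝ) * r₄) x =
      bexp m f₀ x * r₀ + bexp m f₁ x * r₁ + bexp m f₂ x * r₂ + bexp m f₃ x * r₃ + bexp m f₄ x * r₄ := by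
  rw [bexpR_add, bexpR_add, bexpR_add, bexpR_add, bexpR_mul_const, bexpR_mul_const, bexpR_mul_const, bexpR_mul_const,
    bexpR_mul_const, bexpR_intCast, bexpR_intCast, bexpR_intCast, bexpR_intCast, bexpR_intCast]

namespace Verts

variable (V : Verts n)

/-- The twelve side weights as a real vector (bit order of `…KNGoodGMgcCert`). [this work] -/
def X (u : Sym2 (Fin n) → unitInterval) (k : ℕ) : ℝ := (u (V.e k) : ℝ)

/-- The side weights lie in `[0,1]`. [this work] -/
theorem X_mem (u : Sym2 (Fin n) → unitInterval) (k : ℕ) : 0 ≤ V.X u k ∧ V.X u k ≤ 1 :=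
  ⟨(u (V.e k)).2.1, (u (V.e k)).2.2⟩

/-- Reliability of `a` (towards `b`) in the glued core of world `π`. [this work] -/
def rel (u : Sym2 (Fin n) → unitInterval) (b : Fin n) (π : ℕ) (a : Fin n) : ℝ :=
  (prodBernoulli (V.glued u π)).real (openConn a b)

/-- **World mixture.**  Under a pendant `u`, a core reliability of `K` is the mixture of the glued-core reliabilities over the five
worlds, weighted by the world law `bexp 12 (qHat [π]) X` of the side. [this work] -/
theorem real_openConn_worldMix {u : Sym2 (Fin n) → unitInterval} (hP : V.Pendant u) (p q : Fin n)
    (hp : p ∉ ({V.x, V.y, V.z} : Finset (Fin n))) (hq : q ∉ ({V.x, V.y, V.z} : Finset (Fin n))) :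
    (prodBernoulli u).real (openConn p q) =
      bexp 12 (qHat [0]) (V.X u) * (prodBernoulli (V.glued u 0)).real (openConn p q) +
      bexp 12 (qHat [3]) (V.X u) * (prodBernoulli (V.glued u 3)).real (openConn p q) +
      bexp 12 (qHat [5]) (V.X u) * (prodBernoulli (V.glued u 5)).real (openConn p q) +
      bexp 12 (qHat [6]) (V.X u) * (prodBernoulli (V.glued u 6)).real (openConn p q) +
      bexp 12 (qHat [7]) (V.X u) * (prodBernoulli (V.glued u 7)).real (openConn p q) := by
  set R : ℕ → ℝ := fun π => (prodBernoulli (V.glued u π)).real (openConn p q) with hR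
  rw [real_eq_bexpR_force (openConn p q) V.e 12 V.e_inj u]
  have hpt : ∀ c : Cfg, (prodBernoulli (force u V.e 12 c)).real (openConn p q) =
      (qHat [0] c : ℝ) * R 0 + (qHat [3] c : ℝ) * R 3 + (qHat [5] c : ℝ) * R 5 + (qHat [6] c : ℝ) * R 6 + (qHat [7] c : ℝ) * R 7 := by
    intro c
    rw [V.real_openConn_force_side hP c p q hp hq]
    rcases sideWorld_cases c with h | h | h | h | h <;> simp [qHat, h, hR]
  rw [bexpR_congr 12 hpt, bexpR_five]
  simp only [hR]
  show _ = bexp 12 (qHat [0]) (V.X u) * _ + bexp 12 (qHat [3]) (V.X u) * _ + bexp 12 (qHat [5]) (V.X u) * _ +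
    bexp 12 (qHat [6]) (V.X u) * _ + bexp 12 (qHat [7]) (V.X u) * _
  rfl

/-! ## Ties in the glued cores -/

/-- In `[12]`, `a₁` and `a₂` are equally reliable. [this work] -/
theorem rel_tie_12 (u : Sym2 (Fin n) → unitInterval) (b : Fin n) : V.rel u b 3 V.a₁ = V.rel u b 3 V.a₂ :=
  tripleTie_tau_eq_of_weight_one _ V.h12 (by simp [glued]) b
/-- In `[13]`, `a₁` and `a₃` are equally reliable. [this work] -/
theorem rel_tie_13 (u : Sym2 (Fin n) → unitInterval) (b : Fin n) : V.rel u b 5 V.a₁ = V.rel u b 5 V.a₃ :=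
  tripleTie_tau_eq_of_weight_one _ V.h13 (by simp [glued]) b
/-- In `[23]`, `a₂` and `a₃` are equally reliable. [this work] -/
theorem rel_tie_23 (u : Sym2 (Fin n) → unitInterval) (b : Fin n) : V.rel u b 6 V.a₂ = V.rel u b 6 V.a₃ :=
  tripleTie_tau_eq_of_weight_one _ V.h23 (by simp [glued]) b
/-- In `[123]`, `a₁` and `a₂` are equally reliable. [this work] -/
theorem rel_tie_123a (u : Sym2 (Fin n) → unitInterval) (b : Fin n) : V.rel u b 7 V.a₁ = V.rel u b 7 V.a₂ :=
  tripleTie_tau_eq_of_weight_one _ V.h12 (by simp [glued]) b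
/-- In `[123]`, `a₁` and `a₃` are equally reliable. [this work] -/
theorem rel_tie_123b (u : Sym2 (Fin n) → unitInterval) (b : Fin n) : V.rel u b 7 V.a₁ = V.rel u b 7 V.a₃ :=
  tripleTie_tau_eq_of_weight_one _ V.h13 (by simp [glued]) b

/-- The discrete world's glued core is the core. [this work] -/
theorem rel_zero (u : Sym2 (Fin n) → unitInterval) (b a : Fin n) : V.rel u b 0 a = (prodBernoulli (V.core u)).real (openConn a b) := by
  simp [rel, glued_zero]

/-- Relays are off `{x,y,z}`. [this work] -/
theorem a₁_not_mem : V.a₁ ∉ ({V.x, V.y, V.z} : Finset (Fin n)) := by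
  simp [V.hxa₁.symm, V.hya₁.symm, V.hza₁.symm]
/-- Relays are off `{x,y,z}`. [this work] -/
theorem a₂_not_mem : V.a₂ ∉ ({V.x, V.y, V.z} : Finset (Fin n)) := by
  simp [V.hxa₂.symm, V.hya₂.symm, V.hza₂.symm]
/-- Relays are off `{x,y,z}`. [this work] -/
theorem a₃_not_mem : V.a₃ ∉ ({V.x, V.y, V.z} : Finset (Fin n)) := by
  simp [V.hxa₃.symm, V.hya₃.symm, V.hza₃.symm]


/-! ## The loneliness rows in world-law form -/

section rows

variable {u : Sym2 (Fin n) → unitInterval} (hP : V.Pendant u) (b : Fin n)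
  (hb : b ∉ ({V.x, V.y, V.z} : Finset (Fin n)))
include hP hb

/-- **Row `a₂` versus `a₁`**: `μ_u(a₂ b) − μ_u(a₁ b) = Q_d·α − Q₁₃·γ + Q₂₃·δ`. [this work] -/
theorem row_21 :
    (prodBernoulli u).real (openConn V.a₂ b) - (prodBernoulli u).real (openConn V.a₁ b) =
      bexp 12 (qHat [0]) (V.X u) * (V.rel u b 0 V.a₂ - V.rel u b 0 V.a₁) -
      bexp 12 (qHat [5]) (V.X u) * (V.rel u b 5 V.a₁ - V.rel u b 5 V.a₂) +
      bexp 12 (qHat [6]) (V.X u) * (V.rel u b 6 V.a₂ - V.rel u b 6 V.a₁) := by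
  rw [V.real_openConn_worldMix hP V.a₂ b V.a₂_not_mem hb, V.real_openConn_worldMix hP V.a₁ b V.a₁_not_mem hb]
  have t12 := V.rel_tie_12 u b
  have t7 := V.rel_tie_123a u b
  simp only [rel] at t12 t7 ⊢
  rw [t12, t7]
  ring

/-- **Row `a₃` versus `a₁`**: `μ_u(a₃ b) − μ_u(a₁ b) = Q_d·(α+β) − Q₁₂·ε + Q₂₃·δ`. [this work] -/
theorem row_31 :
    (prodBernoulli u).real (openConn V.a₃ b) - (prodBernoulli u).real (openConn V.a₁ b) =
      bexp 12 (qHat [0]) (V.X u) * ((V.rel u b 0 V.a₂ - V.rel u b 0 V.a₁) + (V.rel u b 0 V.a₃ - V.rel u b 0 V.a₂)) -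
      bexp 12 (qHat [3]) (V.X u) * (V.rel u b 3 V.a₁ - V.rel u b 3 V.a₃) +
      bexp 12 (qHat [6]) (V.X u) * (V.rel u b 6 V.a₂ - V.rel u b 6 V.a₁) := by
  rw [V.real_openConn_worldMix hP V.a₃ b V.a₃_not_mem hb, V.real_openConn_worldMix hP V.a₁ b V.a₁_not_mem hb]
  have t13 := V.rel_tie_13 u b
  have t23 := V.rel_tie_23 u b
  have t7 := V.rel_tie_123b u b
  simp only [rel] at t13 t23 t7 ⊢
  rw [t13, t7, t23]
  ring

/-- **Row `a₃` versus `a₂`**: `μ_u(a₃ b) − μ_u(a₂ b) = Q_d·β − Q₁₂·ε + Q₁₃·γ`. [this work] -/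
theorem row_32 :
    (prodBernoulli u).real (openConn V.a₃ b) - (prodBernoulli u).real (openConn V.a₂ b) =
      bexp 12 (qHat [0]) (V.X u) * (V.rel u b 0 V.a₃ - V.rel u b 0 V.a₂) -
      bexp 12 (qHat [3]) (V.X u) * (V.rel u b 3 V.a₁ - V.rel u b 3 V.a₃) +
      bexp 12 (qHat [5]) (V.X u) * (V.rel u b 5 V.a₁ - V.rel u b 5 V.a₂) := by
  rw [V.real_openConn_worldMix hP V.a₃ b V.a₃_not_mem hb, V.real_openConn_worldMix hP V.a₂ b V.a₂_not_mem hb]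
  have t12 := V.rel_tie_12 u b
  have t13 := V.rel_tie_13 u b
  have t23 := V.rel_tie_23 u b
  have t7a := V.rel_tie_123a u b
  have t7b := V.rel_tie_123b u b
  simp only [rel] at t12 t13 t23 t7a t7b ⊢
  rw [t12, t13, t23, ← t7a, t7b]
  ring

end rows

end Verts

end KNGoodGMgc

end Summit.CriticalPhenomena.PercolationContinuityZ3.Theorems

end
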